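/-
Origin: expansion seat `planner-pub-hodgecm-qw8-g11-0`, handover #27 SPLIT PART 2/2 = REPLACE tree `HodgeCM/StubTree/Qw8Geometric.lean` 0df26b3f (557 l.) by md5 21ddefb9c31d2a787ccc3f2059d90609 (317 l.): keeps the module name + module docstring, its earlier sections moved verbatim to rows #26..#26 (Qw8GeometricBlocks); ONE rewrite: `import Qw8g11.Qw8GeometricBlocks` -> `import HodgeCM.StubTree.Qw8GeometricBlocks` (row #26); union of the parts' comment-stripped  (`HOME/pub-hodgecm-qw8-g11/lean/Qw8g11/Qw8Geometric.lean`, md5 21ddefb9, 317 lines);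
landed by the packager successor (mc-unitary-1-g3, gen-8 kit) in gate run 32 REPLACES the earlier landed copy of `HodgeCM/StubTree/Qw8Geometric.lean` (import ^import Qw8g11\.Qw8GeometricBlocks[ \t]*$→import HodgeCM.StubTree.Qw8GeometricBlocks ×1).
-/
-- HANDOVER (planner-pub-hodgecm-qw8-g11-0, unit pub-hodgecm-qw8-g11): SPLIT PART 2/2 = REPLACEMENT of the installed
-- `HodgeCM.StubTree.Qw8Geometric` (md5 0df26b3f, 557 l.): ll. 300–552 verbatim + docstrings; ll. 54–299 moved to `Qw8GeometricBlocks`;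
-- at landing rewrite `import Qw8g11.Qw8GeometricBlocks` ↦ `import HodgeCM.StubTree.Qw8GeometricBlocks` (lands AFTER part 1).
-- Importers (`Qw8Milne`, `Qw8GysinDescent`, …) are unaffected: same module name, same declarations.
/-
Copyright (c) 2026. All rights reserved.
Released under Apache 2.0 license as described in the file LICENSE.
-/
import Summits.HodgeConjecture.HodgeCM.StubTree.Qw8GeometricBlocks

/-!
# [QW8] Thm 2.5 steps (ii) and (iii)+(v) from NAMED STANDARD FACTS of the model

(Split for the 400-line cap: the blocks, the block projections, the five facts F2/F4–F7 and their complexified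
consequences are now the module `HodgeCM.StubTree.Qw8GeometricBlocks`, imported here; the Gysin section, `box_ne_zero`,
steps (ii), (iii)+(v) and the assembly below are unchanged and this docstring still describes the whole.)

`HodgeCM.Universe.Qw8ExtProd` (step (ii): exterior products of algebraic weight vectors) and
`HodgeCM.Universe.Qw8DualPushPull` (steps (iii)+(v): Poincaré-dual partner and Gysin push–pull) were left
OPEN in `HodgeCM/StubTree/Qw8.lean` because the `Universe` signature has no Künneth decomposition, no
Poincaré duality and no push-forward.  This file PROVES both from five named propositions
`Universe.Fact_…` about the intended model (smooth projective varieties / CM abelian varieties, Betti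
cohomology), each a standard textbook fact with its print reference in the docstring, entering as explicit
hypotheses exactly like the fields of `Universe.ModelAxioms` (`HodgeCM.Geometry.Facts`: "every PROPERTY a proof
would use is a separately NAMED proposition … and enters theorems as an explicit hypothesis"); none of them
mentions Hodge classes (FACTS.md AMENDMENT 2 is respected):

* `Fact_factorActDescends` — a factor-wise CM action on `P` descends along the block projections `P → Y`,
  `P → Y'` of a concatenated product (whose existence, `blockPair_exists`, is PROVED from M1, M2, M18);
* `Fact_cupAlg`           — cup products of algebraic classes are algebraic (all degrees);
* `Fact_cupAssoc`         — associativity of the cup product;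
* `Fact_weightDual`       — Poincaré duality of the weight decomposition of `H^•(∏_j A_{Θ_j}, ℂ)` (from which,
  with F5/F7, the Künneth non-vanishing `p_Y^* v ∪ p_{Y'}^* w ≠ 0` — v4's candidate F3 — is PROVED: `box_ne_zero`);
* `Fact_gysin`            — the Gysin map of a block projection preserves algebraic classes; projection formula.

Results: `qw8ExtProd_of_facts`, `qw8DualPushPull_of_facts`, and `qw8Sufficiency_of_facts (M : U.ModelAxioms) … (hMi :
U.Qw8Milne) : U.Qw8Sufficiency` — so that, of [QW8] Thm 2.5, exactly step (iv) = Milne 1999 (the PRINT theorem)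
remains an input.  Degree bookkeeping (`2p + 2q = 2(p+q)` is not definitional) goes through the transport
`castC`; the general complexified cup product is `cupC` (both in the companion module `Qw8CupC` = WIP
`pub-hodgecm-qw8/split/Qw8CupC.lean`, proposed `HodgeCM/Geometry/CupC.lean`; the packager renames the import).  Source: [QW8] v1 892bb948 Thm 2.5 (ii), (iii), (v),
tex ll. 254–258, 260–261 (`inputs/2001/…y3__paper-v1-892bb948.tex` @ a463a4c8cc18).  Speedrun expansion seat
`pub-hodgecm-qw8`, v5 (uses v3 = `HodgeCM.StubTree.Qw8Complement`, landed run 17, for `a(e_{Sᶜ}) = -a(e_S)`;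
v7: v4's candidate facts F1 (block projections) and F3 (Künneth non-degeneracy) are theorems here —
`blockPair_exists`, `box_ne_zero` — and F6 asserts only the NON-VANISHING of `∫ w' ∪ w` and `∫ w ∪ w'`).
-/

noncomputable section

open scoped TensorProduct Classical

namespace HodgeCM

open Literature.AlgebraicGeometry.Motives (CMType)

namespace Universe

variable (U : Universe)

section Gysin

variable {U}
variable {P Y : U.Var} {d : ℕ} (gy : (k : ℕ) → (U.Coh P (k + 2 * d) →ₗ[ℚ] U.Coh Y k))

/-- F7 (i) with complex coefficients. -/
theorem gyC_mem_algC
    (hgy : ∀ (p : ℕ) (z : U.Coh P (2 * (p + d))), z ∈ U.alg P (p + d) →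
      gy (2 * p) (U.castCoh P (by omega) z) ∈ U.alg Y p)
    (p : ℕ) {z : U.CohC P (2 * (p + d))} (hz : z ∈ U.algC P (p + d)) (h : 2 * (p + d) = 2 * p + 2 * d) :
    (gy (2 * p)).baseChange ℂ (U.castC P h z) ∈ U.algC Y p := by
  unfold algC at hz ⊢
  rw [Submodule.baseChange_eq_span] at hz ⊢
  induction hz using Submodule.span_induction with
  | mem z hz =>
    obtain ⟨c, hc, rfl⟩ := hz
    refine Submodule.subset_span ⟨_, hgy p c hc, ?_⟩
    simp [castC_tmul, LinearMap.baseChange_tmul]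
  | zero => simp
  | add y z _ _ hy hz => rw [map_add, map_add]; exact add_mem hy hz
  | smul a y _ hy => rw [map_smul, map_smul]; exact Submodule.smul_mem _ _ hy

/-- F7 (ii) with complex coefficients. -/
theorem gyC_proj {pA : U.Mor P Y} {Y' : U.Var} {pB : U.Mor P Y'}
    (hgy : ∀ (k : ℕ) (e : U.Coh Y k) (ω : U.Coh Y' (2 * d)),
      gy k (U.cup P k (2 * d) (U.pull pA k e) (U.pull pB (2 * d) ω)) = (U.tr Y' (2 * d) ω) • e)
    (k : ℕ) (e : U.CohC Y k) (ω : U.CohC Y' (2 * d)) :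
    (gy k).baseChange ℂ (U.cupC P k (2 * d) (U.pullC pA k e) (U.pullC pB (2 * d) ω)) = (U.trC Y' (2 * d) ω) • e := by
  induction e using TensorProduct.induction_on with
  | zero => simp
  | add a a' ha ha' => simp only [map_add, LinearMap.add_apply, smul_add, ha, ha']
  | tmul α e =>
    induction ω using TensorProduct.induction_on with
    | zero => simp
    | add b b' hb hb' => simp only [map_add, add_smul, hb, hb']
    | tmul β ω =>
      simp only [pullC_tmul, cupC_tmul, LinearMap.baseChange_tmul, hgy, trC_tmul, TensorProduct.tmul_smul,
        TensorProduct.smul_tmul']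
      congr 1
      rw [smul_eq_mul, smul_mul_assoc, mul_comm β α]

end Gysin

/-- **Künneth non-degeneracy from duality and push-forward** (the candidate fact F3 of v4 is now a THEOREM of
M3 `pull_cup`, F5 and F7): if `x ≠ 0` on `Y` and `y` on `Y'` pairs non-trivially with some `y'`
(`∫_{Y'} y ∪ y' ≠ 0`, cf. F6), then `p_Y^* x ∪ p_{Y'}^* y ≠ 0` on `P` — because
`p_{Y*}((p_Y^* x ∪ p_{Y'}^* y) ∪ p_{Y'}^* y') = p_{Y*}(p_Y^* x ∪ p_{Y'}^*(y ∪ y')) = (∫_{Y'} y ∪ y') · x ≠ 0`. -/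
theorem box_ne_zero (M : U.ModelAxioms) (h5 : U.Fact_cupAssoc) (h7 : U.Fact_gysin) {F : CMField} {n m : ℕ}
    (Ξ : Fin (n + 1 + (m + 1)) → CMType F) {pA : U.Mor (U.cmProd F Ξ) (U.cmProd F (blkA Ξ))}
    {pB : U.Mor (U.cmProd F Ξ) (U.cmProd F (blkB Ξ))} (hP : U.IsBlockPair F Ξ pA pB)
    {k : ℕ} {x : U.CohC (U.cmProd F (blkA Ξ)) k} (hx : x ≠ 0) {i j : ℕ}
    (y : U.CohC (U.cmProd F (blkB Ξ)) i) (y' : U.CohC (U.cmProd F (blkB Ξ)) j)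
    (hij : i + j = 2 * U.dim (U.cmProd F (blkB Ξ)))
    (htr : U.trC _ _ (U.castC _ hij (U.cupC _ i j y y')) ≠ 0) :
    U.cupC (U.cmProd F Ξ) k i (U.pullC pA k x) (U.pullC pB i y) ≠ 0 := by
  intro hz
  obtain ⟨gy, -, hgy2⟩ := h7 F n m Ξ pA pB hP
  obtain ⟨ω, hω⟩ : ∃ ω, ω = U.castC _ hij (U.cupC _ i j y y') := ⟨_, rfl⟩
  have hωback : U.cupC _ i j y y' = U.castC _ hij.symm ω := by rw [hω, castC_castC, castC_self]
  have htrω : U.trC _ (2 * U.dim (U.cmProd F (blkB Ξ))) ω ≠ 0 := by rw [hω]; exact htr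
  have calc1 : U.cupC (U.cmProd F Ξ) (k + i) j
      (U.cupC (U.cmProd F Ξ) k i (U.pullC pA k x) (U.pullC pB i y)) (U.pullC pB j y') =
      U.castC _ (by omega : k + 2 * U.dim (U.cmProd F (blkB Ξ)) = k + i + j)
        (U.cupC (U.cmProd F Ξ) k (2 * U.dim (U.cmProd F (blkB Ξ))) (U.pullC pA k x) (U.pullC pB (2 * U.dim (U.cmProd F (blkB Ξ))) ω)) := by
    rw [cupC_assoc U h5, ← pullC_cupC U M.pull_cup, hωback, pullC_castC, cupC_castC_right]
    simp only [castC_castC]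
  have calc2 : (gy k).baseChange ℂ
      (U.cupC (U.cmProd F Ξ) k (2 * U.dim (U.cmProd F (blkB Ξ))) (U.pullC pA k x) (U.pullC pB (2 * U.dim (U.cmProd F (blkB Ξ))) ω)) =
      (U.trC _ (2 * U.dim (U.cmProd F (blkB Ξ))) ω) • x :=
    gyC_proj gy hgy2 k x ω
  rw [hz, map_zero, LinearMap.zero_apply] at calc1
  have h0 : U.cupC (U.cmProd F Ξ) k (2 * U.dim (U.cmProd F (blkB Ξ))) (U.pullC pA k x) (U.pullC pB (2 * U.dim (U.cmProd F (blkB Ξ))) ω) = 0 :=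
    (LinearEquiv.map_eq_zero_iff _).mp calc1.symm
  rw [h0, map_zero] at calc2
  rcases smul_eq_zero.mp calc2.symm with h | h
  · exact htrω h
  · exact hx h


/-! ### Transport of weight-vector data along an equality of CM-type families -/

/-- transport of weight-vector data (non-vanishing, the weight-vector property, algebraicity) along
an equality `Θ₁ = Θ₂` of CM-type families -/
theorem transport_wvec {F : CMField} {n : ℕ} {Θ₁ Θ₂ : Fin (n + 1) → CMType F} (h : Θ₁ = Θ₂) (p : ℕ)
    (S : Fin (n + 1) → Finset ((F : Type) →+* ℂ)) (x : U.CohC (U.cmProd F Θ₁) (2 * p)) :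
    ∃ x₂ : U.CohC (U.cmProd F Θ₂) (2 * p), (x = 0 ↔ x₂ = 0) ∧
      (U.IsWeightVector F Θ₁ S (2 * p) x ↔ U.IsWeightVector F Θ₂ S (2 * p) x₂) ∧
      (x ∈ U.algC (U.cmProd F Θ₁) p ↔ x₂ ∈ U.algC (U.cmProd F Θ₂) p) := by
  subst h; exact ⟨x, Iff.rfl, Iff.rfl, Iff.rfl⟩

/-! ### Step (ii): exterior products -/

section Box

variable {U}

/-- **The exterior product of weight vectors is a weight vector of the concatenated weight** (block setting):
a factor action on `P` descends (F2) and `M^*` is multiplicative (M3). -/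
theorem isWeightVector_box (hcup : U.Fact_pull_cup) (hdesc : U.Fact_factorActDescends)
    {F : CMField} {n m : ℕ} (Ξ : Fin (n + 1 + (m + 1)) → CMType F)
    {pA : U.Mor (U.cmProd F Ξ) (U.cmProd F (blkA Ξ))} {pB : U.Mor (U.cmProd F Ξ) (U.cmProd F (blkB Ξ))}
    (hP : U.IsBlockPair F Ξ pA pB) {k l : ℕ}
    {S : Fin (n + 1) → Finset ((F : Type) →+* ℂ)} {S' : Fin (m + 1) → Finset ((F : Type) →+* ℂ)}
    {x : U.CohC (U.cmProd F (blkA Ξ)) k} {y : U.CohC (U.cmProd F (blkB Ξ)) l}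
    (hx : U.IsWeightVector F (blkA Ξ) S k x) (hy : U.IsWeightVector F (blkB Ξ) S' l y) :
    U.IsWeightVector F Ξ (Fin.append S S' :) (k + l)
      (U.cupC (U.cmProd F Ξ) k l (U.pullC pA k x) (U.pullC pB l y)) := by
  show ∀ t : Fin (n + 1 + (m + 1)), _
  intro t a Mo hMo
  rw [pullC_cupC U hcup]
  induction t using Fin.addCases with
  | left j =>
    obtain ⟨⟨MA, hMA, hcommA⟩, hcommB⟩ := (hdesc F n m Ξ pA pB hP a Mo).1 j hMo
    have e1 : U.pullC Mo k (U.pullC pA k x) = U.pullC pA k (U.pullC MA k x) := by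
      have h := congrArg (LinearMap.baseChange ℂ) (hcommA k)
      rw [LinearMap.baseChange_comp, LinearMap.baseChange_comp] at h
      exact LinearMap.congr_fun h x
    have e2 : U.pullC Mo l (U.pullC pB l y) = U.pullC pB l y := by
      have h := congrArg (LinearMap.baseChange ℂ) (hcommB l)
      rw [LinearMap.baseChange_comp] at h
      exact LinearMap.congr_fun h y
    rw [e1, e2, hx j a MA hMA, map_smul, map_smul, LinearMap.smul_apply, Fin.append_left]
  | right i =>
    obtain ⟨⟨MB, hMB, hcommB⟩, hcommA⟩ := (hdesc F n m Ξ pA pB hP a Mo).2 i hMo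
    have e1 : U.pullC Mo k (U.pullC pA k x) = U.pullC pA k x := by
      have h := congrArg (LinearMap.baseChange ℂ) (hcommA k)
      rw [LinearMap.baseChange_comp] at h
      exact LinearMap.congr_fun h x
    have e2 : U.pullC Mo l (U.pullC pB l y) = U.pullC pB l (U.pullC MB l y) := by
      have h := congrArg (LinearMap.baseChange ℂ) (hcommB l)
      rw [LinearMap.baseChange_comp, LinearMap.baseChange_comp] at h
      exact LinearMap.congr_fun h y
    rw [e1, e2, hy i a MB hMB, map_smul, map_smul, Fin.append_right]

end Box

/-- **[QW8] Thm 2.5 step (ii) from the standard facts**: `Qw8ExtProd` holds in every universe satisfying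
M1, M2, M3 `pull_cup`, M8 `pull_alg`, M18 `lift` and F2, F4–F7 (`z := p_Y^* v ∪ p_{Y'}^* w` on the
concatenated product; non-vanishing by `box_ne_zero`). -/
theorem qw8ExtProd_of_facts (M : U.ModelAxioms) (h2 : U.Fact_factorActDescends) (h4 : U.Fact_cupAlg)
    (h5 : U.Fact_cupAssoc) (h6 : U.Fact_weightDual) (h7 : U.Fact_gysin) : U.Qw8ExtProd := by
  intro F _ _ v w hv hw
  obtain ⟨n, Θ, p, S, x, hx0, hxw⟩ := v
  obtain ⟨m, Θ', q, S', y, hy0, hyw⟩ := w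
  change x ∈ U.algC (U.cmProd F Θ) p at hv
  change y ∈ U.algC (U.cmProd F Θ') q at hw
  let Ξ : Fin (n + 1 + (m + 1)) → CMType F := Fin.append Θ Θ'
  have hA : blkA Ξ = Θ := blkA_append Θ Θ'
  have hB : blkB Ξ = Θ' := blkB_append Θ Θ'
  obtain ⟨x₂, h0x, hwx, hax⟩ := U.transport_wvec hA.symm p S x
  obtain ⟨y₂, h0y, hwy, hay⟩ := U.transport_wvec hB.symm q S' y
  obtain ⟨pA, pB, hP⟩ := U.blockPair_exists M.pull_id M.pull_comp M.lift F n m Ξ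
  have hdeg : 2 * p + 2 * q = 2 * (p + q) := by omega
  -- `z := p_Y^* v ∪ p_{Y'}^* w ≠ 0`: by duality (F6, right partner of `w`) and push–pull (`box_ne_zero`)
  obtain ⟨hq, y', -, -, htr2⟩ := h6 F m (blkB Ξ) q S' y₂ (fun h => hy0 (h0y.mpr h)) (hwy.mp hyw)
  have hij : 2 * q + 2 * (U.dim (U.cmProd F (blkB Ξ)) - q) = 2 * U.dim (U.cmProd F (blkB Ξ)) := by omega
  have hz0 : U.cupC (U.cmProd F Ξ) (2 * p) (2 * q) (U.pullC pA (2 * p) x₂) (U.pullC pB (2 * q) y₂) ≠ 0 :=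
    U.box_ne_zero M h5 h7 Ξ hP (fun h => hx0 (h0x.mpr h)) y₂ y' hij (by rw [trC_castC]; exact htr2)
  have hzw := isWeightVector_box M.pull_cup h2 Ξ hP (hwx.mp hxw) (hwy.mp hyw)
  refine ⟨⟨n + 1 + m, Ξ, p + q, (Fin.append S S' :), U.castC _ hdeg
      (U.cupC (U.cmProd F Ξ) (2 * p) (2 * q) (U.pullC pA (2 * p) x₂) (U.pullC pB (2 * q) y₂)),
      fun h => hz0 ((LinearEquiv.map_eq_zero_iff _).mp h), U.isWeightVector_castC F Ξ _ hdeg hzw⟩, ?_, ?_⟩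
  · exact U.cupC_mem_algC h4 _ p q (U.pullC_mem_algC M.pull_alg pA p (hax.mp hv))
      (U.pullC_mem_algC M.pull_alg pB q (hay.mp hw)) hdeg
  · show lefChar Ξ (Fin.append S S' :) = lefChar Θ S + lefChar Θ' S'
    rw [lefChar_append, lefChar_congr hA, lefChar_congr hB]

/-! ### Steps (iii)+(v): the Poincaré-dual partner and the Gysin push–pull -/

/-- **[QW8] Thm 2.5 steps (iii)+(v) from the standard facts**: `Qw8DualPushPull` holds in every universe
satisfying M1, M2, M3, M8, M18 and F2, F4–F7.  Construction: `Z := p_Y^* e ∪ p_{Y'}^* W'` with `W'` the dual partner of `W`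
(F6, normalised to `∫ W' ∪ W = 1`); `a(Z) = a(e) + a(e_{Sᶜ}) = a(e) - a(W)` (`lefChar_append`, `lefChar_add_lefChar_compl`); if `Z` is
algebraic then so is `Z ∪ p_{Y'}^* W = p_Y^* e ∪ p_{Y'}^*(W' ∪ W)` (F4, F5, M3, M8) and hence
`e = p_{Y*}(Z ∪ p_{Y'}^* W)` (F7: `∫ W' ∪ W = 1`). -/
theorem qw8DualPushPull_of_facts (M : U.ModelAxioms) (h2 : U.Fact_factorActDescends) (h4 : U.Fact_cupAlg)
    (h5 : U.Fact_cupAssoc) (h6 : U.Fact_weightDual) (h7 : U.Fact_gysin) : U.Qw8DualPushPull := by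
  intro F _ _ e W hW
  obtain ⟨n, Θ, p, S, x, hx0, hxw⟩ := e
  obtain ⟨m, Θ', q, S', w, hw0, hww⟩ := W
  change w ∈ U.algC (U.cmProd F Θ') q at hW
  let Ξ : Fin (n + 1 + (m + 1)) → CMType F := Fin.append Θ Θ'
  have hA : blkA Ξ = Θ := blkA_append Θ Θ'
  have hB : blkB Ξ = Θ' := blkB_append Θ Θ'
  obtain ⟨x₂, h0x, hwx, hax⟩ := U.transport_wvec hA.symm p S x
  obtain ⟨w₂, h0w, hww₂, haw⟩ := U.transport_wvec hB.symm q S' w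
  obtain ⟨pA, pB, hP⟩ := U.blockPair_exists M.pull_id M.pull_comp M.lift F n m Ξ
  -- (iii) the dual partner `w'` of `W` on the second block
  obtain ⟨hq, w₁, hw₁, htr₁, -⟩ := h6 F m (blkB Ξ) q S' w₂ (fun h => hw0 (h0w.mpr h)) (hww₂.mp hww)
  -- normalise: `w' := (∫ w₁ ∪ W)⁻¹ • w₁`, so that `∫ w' ∪ W = 1`
  obtain ⟨w', hw', htr⟩ : ∃ w' : U.CohC (U.cmProd F (blkB Ξ)) (2 * (U.dim (U.cmProd F (blkB Ξ)) - q)),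
      U.IsWeightVector F (blkB Ξ) (fun i => (S' i)ᶜ) (2 * (U.dim (U.cmProd F (blkB Ξ)) - q)) w' ∧
      U.trC (U.cmProd F (blkB Ξ)) _ (U.cupC (U.cmProd F (blkB Ξ)) _ _ w' w₂) = 1 := by
    refine ⟨(U.trC (U.cmProd F (blkB Ξ)) _ (U.cupC (U.cmProd F (blkB Ξ)) _ _ w₁ w₂))⁻¹ • w₁, ?_, ?_⟩
    · intro j a N hN
      rw [map_smul, hw₁ j a N hN, smul_comm]
    · rw [map_smul, LinearMap.smul_apply, map_smul, smul_eq_mul, inv_mul_cancel₀ htr₁]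
  have h6' : 2 * (U.dim (U.cmProd F (blkB Ξ)) - q) + 2 * q = 2 * U.dim (U.cmProd F (blkB Ξ)) := by omega
  -- `Z := p_Y^* e ∪ p_{Y'}^* w'`
  have hdeg : 2 * p + 2 * (U.dim (U.cmProd F (blkB Ξ)) - q) = 2 * (p + (U.dim (U.cmProd F (blkB Ξ)) - q)) := by omega
  have hZ0 : U.cupC (U.cmProd F Ξ) (2 * p) (2 * (U.dim (U.cmProd F (blkB Ξ)) - q)) (U.pullC pA (2 * p) x₂)
      (U.pullC pB (2 * (U.dim (U.cmProd F (blkB Ξ)) - q)) w') ≠ 0 :=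
    U.box_ne_zero M h5 h7 Ξ hP (fun h => hx0 (h0x.mpr h)) w' w₂ h6' (by rw [trC_castC, htr]; exact one_ne_zero)
  have hZw := isWeightVector_box M.pull_cup h2 Ξ hP (hwx.mp hxw) hw'
  refine ⟨⟨n + 1 + m, Ξ, p + (U.dim (U.cmProd F (blkB Ξ)) - q), (Fin.append S (fun i => (S' i)ᶜ) :), U.castC _ hdeg
      (U.cupC (U.cmProd F Ξ) (2 * p) (2 * (U.dim (U.cmProd F (blkB Ξ)) - q)) (U.pullC pA (2 * p) x₂) (U.pullC pB (2 * (U.dim (U.cmProd F (blkB Ξ)) - q)) w')),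
      fun h => hZ0 ((LinearEquiv.map_eq_zero_iff _).mp h), U.isWeightVector_castC F Ξ _ hdeg hZw⟩, ?_, ?_⟩
  · -- `a(Z) = a(e) - a(W)`
    show lefChar Ξ (Fin.append S (fun i => (S' i)ᶜ) :) = lefChar Θ S - lefChar Θ' S'
    rw [lefChar_append, lefChar_congr hA, lefChar_congr hB,
      eq_neg_of_add_eq_zero_right (lefChar_add_lefChar_compl Θ' S'), sub_eq_add_neg]
  · -- (v) `Z` algebraic ⇒ `e` algebraic
    intro hZalg
    change U.castC _ hdeg (U.cupC (U.cmProd F Ξ) (2 * p) (2 * (U.dim (U.cmProd F (blkB Ξ)) - q)) (U.pullC pA (2 * p) x₂)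
      (U.pullC pB (2 * (U.dim (U.cmProd F (blkB Ξ)) - q)) w')) ∈ U.algC (U.cmProd F Ξ) (p + (U.dim (U.cmProd F (blkB Ξ)) - q)) at hZalg
    show x ∈ U.algC (U.cmProd F Θ) p
    refine hax.mpr ?_
    obtain ⟨gy, hgy1, hgy2⟩ := h7 F n m Ξ pA pB hP
    -- `Z ∪ p_{Y'}^* W` is algebraic, in the degree `2p + 2 dim Y'` where `p_{Y*}` applies
    have hpB : U.pullC pB (2 * q) w₂ ∈ U.algC (U.cmProd F Ξ) q := U.pullC_mem_algC M.pull_alg pB q (haw.mp hW)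
    have hdeg1 : 2 * (p + (U.dim (U.cmProd F (blkB Ξ)) - q)) + 2 * q = 2 * (p + (U.dim (U.cmProd F (blkB Ξ)) - q) + q) := by omega
    have hA1 := U.cupC_mem_algC h4 _ (p + (U.dim (U.cmProd F (blkB Ξ)) - q)) q hZalg hpB hdeg1
    have hidx : p + (U.dim (U.cmProd F (blkB Ξ)) - q) + q = p + U.dim (U.cmProd F (blkB Ξ)) := by omega
    have hA2 := (U.castC_mem_algC_iff (U.cmProd F Ξ) hidx (by omega) _).mpr hA1
    have hA3 := gyC_mem_algC gy hgy1 p hA2 (by omega)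
    -- … and equals `p_Y^* e ∪ p_{Y'}^* (w' ∪ W)` there
    obtain ⟨ω, hω⟩ : ∃ ω, ω = U.castC _ h6' (U.cupC _ (2 * (U.dim (U.cmProd F (blkB Ξ)) - q)) (2 * q) w' w₂) := ⟨_, rfl⟩
    have hωback : U.cupC _ (2 * (U.dim (U.cmProd F (blkB Ξ)) - q)) (2 * q) w' w₂ = U.castC _ h6'.symm ω := by
      rw [hω, castC_castC, castC_self]
    have htrω : U.trC _ (2 * U.dim (U.cmProd F (blkB Ξ))) ω = 1 := by
      rw [hω, trC_castC]; exact htr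
    have calc1 : U.cupC (U.cmProd F Ξ) (2 * (p + (U.dim (U.cmProd F (blkB Ξ)) - q))) (2 * q) (U.castC _ hdeg
        (U.cupC (U.cmProd F Ξ) (2 * p) (2 * (U.dim (U.cmProd F (blkB Ξ)) - q)) (U.pullC pA (2 * p) x₂) (U.pullC pB (2 * (U.dim (U.cmProd F (blkB Ξ)) - q)) w')))
        (U.pullC pB (2 * q) w₂) =
        U.castC _ (by omega : 2 * p + 2 * U.dim (U.cmProd F (blkB Ξ)) = 2 * (p + (U.dim (U.cmProd F (blkB Ξ)) - q)) + 2 * q)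
          (U.cupC (U.cmProd F Ξ) (2 * p) (2 * U.dim (U.cmProd F (blkB Ξ))) (U.pullC pA (2 * p) x₂) (U.pullC pB (2 * U.dim (U.cmProd F (blkB Ξ))) ω)) := by
      rw [cupC_castC_left, cupC_assoc U h5, ← pullC_cupC U M.pull_cup, hωback, pullC_castC, cupC_castC_right]
      simp only [castC_castC]
    have calc2 : (gy (2 * p)).baseChange ℂ
        (U.cupC (U.cmProd F Ξ) (2 * p) (2 * U.dim (U.cmProd F (blkB Ξ))) (U.pullC pA (2 * p) x₂) (U.pullC pB (2 * U.dim (U.cmProd F (blkB Ξ))) ω)) = x₂ := by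
      rw [gyC_proj gy hgy2, htrω, one_smul]
    rw [calc1] at hA3
    simp only [castC_castC, castC_self] at hA3
    rwa [calc2] at hA3

/-! ### Assembly: [QW8] Thm 2.5 with Milne 1999 as the only remaining input -/

/-- **`Qw8Sufficiency` from the model axioms, the five standard facts F2, F4–F7, and Milne 1999** (step (iv),
`Qw8Milne`).  Steps (i), (ii), (iii)+(v) and the §3 ā-bridge are theorems (`qw8Conj_holds`,
`qw8ExtProd_of_facts`, `qw8DualPushPull_of_facts`, `qw8FaceBridge_holds`). -/
theorem qw8Sufficiency_of_facts (M : U.ModelAxioms) (h2 : U.Fact_factorActDescends) (h4 : U.Fact_cupAlg)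
    (h5 : U.Fact_cupAssoc) (h6 : U.Fact_weightDual) (h7 : U.Fact_gysin) (hMi : U.Qw8Milne) : U.Qw8Sufficiency :=
  U.qw8Sufficiency_of_modelAxioms M (U.qw8ExtProd_of_facts M h2 h4 h5 h6 h7)
    (U.qw8DualPushPull_of_facts M h2 h4 h5 h6 h7) hMi

end Universe

end HodgeCM

end
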